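import Literature.NumberTheory.Transcendental.RoySmallValueEstimatesMultiplicityProofs
import HarnessLib

/-!
# Small value estimates at rational translates (Nguyen–Roy 2016) — proofs, XVIII: ideals of points and the multiplicity along `(I_D^{(T)})^{m+1}`

Eighteenth proofs file towards `Literature.NumberTheory.Transcendental.nguyenRoy2016_thm_1` (Nguyen–Roy,
IJNT 12 (2016) = arXiv:1412.5163). In the proof of Proposition 15 the authors "apply Theorem 5.6 of
[R2012] to the ideal `I^{(T)}`" (the ideal of the `T` points `γ₀, …, γ_{T−1}`, Definition 9) and
"conclude that the resultant in degree `D`, viewed as a polynomial map `Res_D : ℂ[X]_D³ → ℂ`,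
vanishes up to order `T` at each triple of elements of `I_D^{(T)}`". With multiplicity `1`,
Theorem 5.6 of Roy (Mathematika 59 (2013) = arXiv:1301.0663) reduces to Theorem 5.2 (file XVII)
plus `deg I^{(T)} = T`. This file PROVES, over any field `K`:

* `NguyenRoyK.pointIdeal Z` — the ideal generated by the forms vanishing on a finite set `Z` of
  (representatives of) points; `mem_idealPart_pointIdeal_iff` (its degree-`ν` part is the space of
  forms of degree `ν` vanishing on `Z`);
* `exists_form_separating` — for `T` pairwise non-proportional non-zero points and `ν ≥ T − 1`, forms
  of degree `ν` separating them (products of linear forms), hence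
  **`hilbH_pointIdeal : H(I^{(T)}; ν) = T`** (rank–nullity for the evaluation map);
* **`X_pow_card_dvd_aeval_line_detPhi_pointIdeal`** — for ANY decomposition data `𝒟` (e.g. the pure
  powers, file XV), `t^T ∣ Φ_𝒟(q + tw)` for every tuple `q` of forms of degree `D` vanishing at the
  `T` points and every direction `w` (Theorem 5.2, step 1, needs no hypothesis on `Z(I_D)`);
* **`X_pow_card_dvd_aeval_line_resD_pointIdeal`** — the same for `Res_D` (`char K = 0`, `m ≥ 1`,
  `D ≥ 2`) given decomposition data whose first `m` forms vanish at the points (Theorem 5.2).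

* `nrPt/nrPts` — the Nguyen–Roy points `γ̲_i = (1, ξ + ir, η sⁱ)`, in general position for `r ≠ 0`
  (`card_nrPts`, `nrPts_general_position`), so **`hilbH_pointIdeal_nrPts : H(I^{(T)}; ν) = T`** and
  **`X_pow_dvd_aeval_line_detPhi_nrPts : t^T ∣ Φ(q + tw)`** for `q ∈ (I_D^{(T)})³`.

No named facts; `pointIdeal`, `nrPt`, `nrPts` are the only definitions.

## References

* [NguyenRoy2016] N. A. V. Nguyen, D. Roy, IJNT 12 (2016) = arXiv:1412.5163, Definition 9 and §5,
  proof of Proposition 15 (the appeal to [R2012, Theorem 5.6]).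
* [Roy2013] D. Roy, *A small value estimate for 𝔾ₐ × 𝔾ₘ*, Mathematika 59 (2013) = arXiv:1301.0663,
  §5, Theorems 5.2 and 5.6 (and `deg(I) = T|Σ|` in the proof of Theorem 5.6).
-/

noncomputable section

open MvPolynomial Finset

attribute [local instance] MvPolynomial.gradedAlgebra

namespace Literature.NumberTheory.Transcendental

namespace NguyenRoyK

open NguyenRoy (MonoIdx monoIdxEquivSym fintypeMonoIdx card_monoIdx veroN veroN_succ veroEquiv vexp
  degree_vexp vidx vexp_vidx vexp_injective nuD nuD_spec specForm isHomogeneous_specForm aeval_specForm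
  eq_zero_of_forall_coeff)

attribute [local instance] NguyenRoy.fintypeMonoIdx

/-! ## Ideals of finite sets of points: `H(I; ν) = #points` in large degree -/

section PointIdeal

attribute [local instance] NguyenRoy.finiteDimensional_homogeneousSubmodule

variable {K : Type*} [Field K] {m : ℕ}

/-- **The ideal of a finite set of points** `Z ⊂ K^{m+1}` (representatives of points of `ℙ^m`):
generated by the homogeneous polynomials vanishing on `Z` (Roy's `I = ∩_γ I^{(γ,1)}`, Nguyen–Roy's
`I^{(T)}` for the `T` points `γ₀, …, γ_{T−1}`). [cite: NguyenRoy2016, Definition 9] -/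
def pointIdeal (Z : Finset (Fin (m + 1) → K)) : Ideal (MvPolynomial (Fin (m + 1)) K) :=
  Ideal.span {F | (∃ n, F.IsHomogeneous n) ∧ ∀ z ∈ Z, MvPolynomial.eval z F = 0}

/-- Homogeneous polynomials vanishing on `Z` lie in its ideal. [folklore] -/
theorem mem_pointIdeal {Z : Finset (Fin (m + 1) → K)} {F : MvPolynomial (Fin (m + 1)) K} {n : ℕ}
    (hF : F.IsHomogeneous n) (hz : ∀ z ∈ Z, MvPolynomial.eval z F = 0) : F ∈ pointIdeal Z :=
  Ideal.subset_span ⟨⟨n, hF⟩, hz⟩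

/-- Every element of the ideal of `Z` vanishes on `Z`. [folklore] -/
theorem eval_eq_zero_of_mem_pointIdeal {Z : Finset (Fin (m + 1) → K)} {F : MvPolynomial (Fin (m + 1)) K}
    (hF : F ∈ pointIdeal Z) {z : Fin (m + 1) → K} (hz : z ∈ Z) : MvPolynomial.eval z F = 0 := by
  have hle : pointIdeal Z ≤ RingHom.ker (MvPolynomial.eval z) := by
    rw [pointIdeal, Ideal.span_le]
    rintro G ⟨-, hG⟩
    exact hG z hz
  exact hle hF

/-- The degree-`ν` part of the ideal of `Z` is the space of forms of degree `ν` vanishing on `Z`.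
[folklore] -/
theorem mem_idealPart_pointIdeal_iff {Z : Finset (Fin (m + 1) → K)} {ν : ℕ} {F : MvPolynomial (Fin (m + 1)) K} :
    F ∈ idealPart (pointIdeal Z) ν ↔ F.IsHomogeneous ν ∧ ∀ z ∈ Z, MvPolynomial.eval z F = 0 := by
  rw [mem_idealPart_iff]
  constructor
  · rintro ⟨hI, hF⟩
    exact ⟨hF, fun z hz => eval_eq_zero_of_mem_pointIdeal hI hz⟩
  · rintro ⟨hF, hz⟩
    exact ⟨mem_pointIdeal hF hz, hF⟩

/-- A linear form killing `z'` but not `z`, for non-proportional `z, z'`. [folklore] -/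
theorem exists_linear_separating {z z' : Fin (m + 1) → K} (h : ∃ i j, z i * z' j ≠ z j * z' i) :
    ∃ ℓ : MvPolynomial (Fin (m + 1)) K, ℓ.IsHomogeneous 1 ∧ MvPolynomial.eval z' ℓ = 0 ∧
      MvPolynomial.eval z ℓ ≠ 0 := by
  obtain ⟨i, j, hij⟩ := h
  refine ⟨C (z' j) * X i - C (z' i) * X j, ?_, ?_, ?_⟩
  · exact ((isHomogeneous_C _ _).mul (isHomogeneous_X _ _)).sub
      ((isHomogeneous_C _ _).mul (isHomogeneous_X _ _))
  · simp only [map_sub, map_mul, eval_C, eval_X]; ring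
  · simp only [map_sub, map_mul, eval_C, eval_X]
    intro h0
    apply hij
    linear_combination h0

/-- **Points in general position (pairwise non-proportional, non-zero) are separated by forms of
every degree `ν ≥ #Z − 1`**: for each `z ∈ Z` a form of degree `ν` vanishing on `Z ∖ {z}` but not at
`z` (a product of linear forms). [folklore] -/
theorem exists_form_separating (Z : Finset (Fin (m + 1) → K)) (hZ0 : ∀ z ∈ Z, z ≠ 0)
    (hZ : ∀ z ∈ Z, ∀ z' ∈ Z, z ≠ z' → ∃ i j, z i * z' j ≠ z j * z' i) {ν : ℕ} (hν : Z.card ≤ ν + 1)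
    {z : Fin (m + 1) → K} (hz : z ∈ Z) :
    ∃ F : MvPolynomial (Fin (m + 1)) K, F.IsHomogeneous ν ∧ (∀ z' ∈ Z, z' ≠ z → MvPolynomial.eval z' F = 0) ∧
      MvPolynomial.eval z F ≠ 0 := by
  classical
  -- separating linear forms
  have hsep : ∀ z' ∈ Z.erase z, ∃ ℓ : MvPolynomial (Fin (m + 1)) K, ℓ.IsHomogeneous 1 ∧
      MvPolynomial.eval z' ℓ = 0 ∧ MvPolynomial.eval z ℓ ≠ 0 := fun z' hz' =>
    exists_linear_separating (hZ z hz z' (Finset.mem_of_mem_erase hz') (Finset.ne_of_mem_erase hz').symm)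
  choose ℓ hℓ using hsep
  -- a coordinate non-vanishing at `z`
  obtain ⟨i₀, hi₀⟩ := Function.ne_iff.mp (hZ0 z hz)
  have hcard : (Z.erase z).card + (ν + 1 - Z.card) = ν := by
    rw [Finset.card_erase_of_mem hz]
    have := Finset.card_pos.mpr ⟨z, hz⟩
    omega
  refine ⟨(∏ z' ∈ (Z.erase z).attach, ℓ z'.1 z'.2) * X i₀ ^ (ν + 1 - Z.card), ?_, ?_, ?_⟩
  · have h1 : (∏ z' ∈ (Z.erase z).attach, ℓ z'.1 z'.2).IsHomogeneous (∑ _z' ∈ (Z.erase z).attach, 1) :=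
      IsHomogeneous.prod _ _ _ fun z' _ => (hℓ z'.1 z'.2).1
    rw [Finset.sum_const, Finset.card_attach, smul_eq_mul, mul_one] at h1
    have h := h1.mul (isHomogeneous_X_pow (R := K) i₀ (ν + 1 - Z.card))
    rwa [hcard] at h
  · intro z' hz' hne
    rw [map_mul, map_prod]
    apply mul_eq_zero_of_left
    have hmem : z' ∈ Z.erase z := Finset.mem_erase.mpr ⟨hne, hz'⟩
    exact Finset.prod_eq_zero (Finset.mem_attach _ ⟨z', hmem⟩) (hℓ z' hmem).2.1
  · rw [map_mul, map_prod, map_pow, eval_X]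
    refine mul_ne_zero ?_ (pow_ne_zero _ hi₀)
    exact Finset.prod_ne_zero_iff.mpr fun z' _ => (hℓ z'.1 z'.2).2.2

/-- **The Hilbert function of the ideal of `T` points in general position is `T` in every degree
`ν ≥ T − 1`**: the evaluation map `K[x]_ν → K^Z` is onto (separating forms) and its kernel is `I_ν`.
For Nguyen–Roy this is `deg I^{(T)} = T`; in Roy's Theorem 5.6, `deg(I) = T|Σ|` with `T = 1`.
[cite: Roy2013, proof of Theorem 5.6] -/
theorem hilbH_pointIdeal (Z : Finset (Fin (m + 1) → K)) (hZ0 : ∀ z ∈ Z, z ≠ 0)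
    (hZ : ∀ z ∈ Z, ∀ z' ∈ Z, z ≠ z' → ∃ i j, z i * z' j ≠ z j * z' i) {ν : ℕ} (hν : Z.card ≤ ν + 1) :
    hilbH (pointIdeal Z) ν = Z.card := by
  classical
  -- the evaluation map
  let ev : homogeneousSubmodule (Fin (m + 1)) K ν →ₗ[K] (Z → K) :=
    LinearMap.pi fun z => (MvPolynomial.aeval (R := K) (z.1 : Fin (m + 1) → K)).toLinearMap.comp
      (homogeneousSubmodule (Fin (m + 1)) K ν).subtype
  have hev : ∀ (F : homogeneousSubmodule (Fin (m + 1)) K ν) (z : Z),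
      ev F z = MvPolynomial.eval (z.1 : Fin (m + 1) → K) (F : MvPolynomial (Fin (m + 1)) K) := by
    intro F z
    simp [ev]
  -- kernel = `I_ν`
  have hker : LinearMap.ker ev = (idealPart (pointIdeal Z) ν).comap (homogeneousSubmodule (Fin (m + 1)) K ν).subtype := by
    ext F
    rw [LinearMap.mem_ker, Submodule.mem_comap, Submodule.subtype_apply, mem_idealPart_pointIdeal_iff]
    constructor
    · intro h
      refine ⟨F.2, fun z hz => ?_⟩
      have := congrFun h ⟨z, hz⟩
      rwa [hev, Pi.zero_apply] at this
    · rintro ⟨-, h⟩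
      funext z
      rw [hev, Pi.zero_apply]
      exact h z.1 z.2
  -- surjectivity
  have hsurj : Function.Surjective ev := by
    have hbasis : ∀ z : Z, ∃ F : homogeneousSubmodule (Fin (m + 1)) K ν, ∃ c : K, c ≠ 0 ∧ ev F = Pi.single z c := by
      intro z
      obtain ⟨F, hF, hvan, hne⟩ := exists_form_separating Z hZ0 hZ hν z.2
      refine ⟨⟨F, hF⟩, MvPolynomial.eval (z.1 : Fin (m + 1) → K) F, hne, ?_⟩
      funext z'
      rw [hev, Pi.single_apply]
      split_ifs with h
      · subst h; rfl
      · exact hvan z'.1 z'.2 (fun h' => h (Subtype.ext h'))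
    intro y
    choose F c hc hF using hbasis
    refine ⟨∑ z, (y z * (c z)⁻¹) • F z, ?_⟩
    rw [map_sum]
    funext z'
    simp only [Finset.sum_apply, map_smul, Pi.smul_apply, hF, Pi.single_apply, smul_eq_mul, mul_ite, mul_zero]
    rw [Finset.sum_ite_eq]
    simp only [Finset.mem_univ, if_true]
    field_simp [hc z']
  -- rank–nullity
  have hrn := LinearMap.finrank_range_add_finrank_ker ev
  rw [LinearMap.range_eq_top.mpr hsurj, finrank_top, Module.finrank_fintype_fun_eq_card,
    Fintype.card_coe, hker] at hrn
  have hcomap : Module.finrank K ((idealPart (pointIdeal Z) ν).comap (homogeneousSubmodule (Fin (m + 1)) K ν).subtype) =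
      Module.finrank K (idealPart (pointIdeal Z) ν) :=
    (Submodule.comapSubtypeEquivOfLe
      (inf_le_right : idealPart (pointIdeal Z) ν ≤ homogeneousSubmodule (Fin (m + 1)) K ν)).finrank_eq
  rw [hilbH, ← hrn, hcomap]
  omega

/-! ### The multiplicity estimate along `(I_D^{(T)})^{m+1}` for `T` points -/

namespace DecompData

variable {D ν : ℕ} {P : ℕ → MvPolynomial (Fin (m + 1)) K}

/-- **`Φ` vanishes to order `T` at each point of `(I_D^{(T)})^{m+1}`**, `I^{(T)}` the ideal of `T`
points of `ℙ^m(K)` in general position (pairwise distinct points with non-zero representatives),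
`ν ≥ T − 1`: for any decomposition data `𝒟` (e.g. `purePowData`), every tuple `q` of forms of degree
`D` vanishing at the points and every direction `w`, `t^T ∣ Φ_𝒟(q + tw)`. This is the form in which
Nguyen–Roy use Roy's Theorem 5.6 (with `Σ` = the `T` translates, multiplicity `1`), for the
determinant `Φ` of the proof of Theorem 5.2. [cite: NguyenRoy2016, §5, proof of Proposition 15] -/
theorem X_pow_card_dvd_aeval_line_detPhi_pointIdeal (𝒟 : DecompData K m D ν P)
    (hP : ∀ j, (P j).IsHomogeneous D) (hDν : D ≤ ν) (Z : Finset (Fin (m + 1) → K))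
    (hZ0 : ∀ z ∈ Z, z ≠ 0) (hZ : ∀ z ∈ Z, ∀ z' ∈ Z, z ≠ z' → ∃ i j, z i * z' j ≠ z j * z' i)
    (hν : Z.card ≤ ν + 1) {q : Fin (m + 1) × Fin (veroN m D + 1) → K}
    (hq : ∀ i, specForm m D q i ∈ pointIdeal Z) (w : Fin (m + 1) × Fin (veroN m D + 1) → K) :
    Polynomial.X ^ Z.card ∣
      aeval (fun v => Polynomial.C (q v) + Polynomial.C (w v) * Polynomial.X) (detPhi (𝒟 := 𝒟) hP hDν) := by
  rw [← hilbH_pointIdeal Z hZ0 hZ hν]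
  exact X_pow_hilbH_dvd_aeval_line_detPhi (𝒟 := 𝒟) hP hDν _ hq w

/-- **`Res_D` vanishes to order `T` at each point of `(I_D^{(T)})^{m+1}`** (Roy's Theorem 5.6 with
multiplicity `1`, `char K = 0`, `m ≥ 1`, `D ≥ 2`), given decomposition data `𝒟` whose first `m`
forms vanish at the `T` points (file XVI constructs such data from a regular sequence in `I_D` and a
zero-free last form). [cite: Roy2013, Theorems 5.2 and 5.6] -/
theorem X_pow_card_dvd_aeval_line_resD_pointIdeal [CharZero K] (𝒟 : DecompData K m D ν P)
    (hm : 1 ≤ m) (hD2 : 2 ≤ D) (hP : ∀ j, (P j).IsHomogeneous D) (hDν : D ≤ ν)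
    (Z : Finset (Fin (m + 1) → K)) (hZ0 : ∀ z ∈ Z, z ≠ 0)
    (hZ : ∀ z ∈ Z, ∀ z' ∈ Z, z ≠ z' → ∃ i j, z i * z' j ≠ z j * z' i) (hν : Z.card ≤ ν + 1)
    (hPZ : ∀ j < m, P j ∈ pointIdeal Z) {q : Fin (m + 1) × Fin (veroN m D + 1) → K}
    (hq : ∀ i, specForm m D q i ∈ pointIdeal Z) (w : Fin (m + 1) × Fin (veroN m D + 1) → K) :
    Polynomial.X ^ Z.card ∣
      aeval (fun v => Polynomial.C (q v) + Polynomial.C (w v) * Polynomial.X) (resD K m D) := by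
  rw [← hilbH_pointIdeal Z hZ0 hZ hν]
  exact X_pow_hilbH_dvd_aeval_line_resD 𝒟 hm hD2 hP hDν _ hPZ hq w

end DecompData

/-! ### The Nguyen–Roy points `γ̲_i = (1, ξ + ir, η sⁱ)` -/

section NRPoints

variable {L : Type*} [Field L]

/-- The representatives `γ̲_i = (1, ξ + ir, η sⁱ) ∈ L³` of the translates `γ_i = τⁱ(γ₀)`
(`0 ≤ i < T`). [cite: NguyenRoy2016, §2] -/
def nrPt (ξ η r s : L) (i : ℕ) : Fin 3 → L := ![1, ξ + i * r, η * s ^ i]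

/-- The set `{γ̲_0, …, γ̲_{T−1}}`. [cite: NguyenRoy2016, Definition 9] -/
def nrPts [DecidableEq L] (ξ η r s : L) (T : ℕ) : Finset (Fin 3 → L) :=
  (Finset.range T).image (nrPt ξ η r s)

/-- First coordinate of `γ̲_i`. [folklore] -/
theorem nrPt_zero_apply (ξ η r s : L) (i : ℕ) : nrPt ξ η r s i 0 = 1 := rfl

/-- Second coordinate of `γ̲_i`. [folklore] -/
theorem nrPt_one_apply (ξ η r s : L) (i : ℕ) : nrPt ξ η r s i 1 = ξ + i * r := rfl

/-- The `γ̲_i` are non-zero. [folklore] -/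
theorem nrPt_ne_zero (ξ η r s : L) (i : ℕ) : nrPt ξ η r s i ≠ 0 := by
  intro h
  have := congrFun h 0
  rw [nrPt_zero_apply, Pi.zero_apply] at this
  exact one_ne_zero this

/-- `i ↦ γ̲_i` is injective for `r ≠ 0` in characteristic zero. [folklore] -/
theorem nrPt_injective [CharZero L] (ξ η : L) {r : L} (hr : r ≠ 0) (s : L) :
    Function.Injective (nrPt ξ η r s) := by
  intro i j h
  have h1 := congrFun h 1
  rw [nrPt_one_apply, nrPt_one_apply, add_right_inj] at h1
  exact_mod_cast mul_right_cancel₀ hr h1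

/-- `#{γ̲_0, …, γ̲_{T−1}} = T`. [folklore] -/
theorem card_nrPts [DecidableEq L] [CharZero L] (ξ η : L) {r : L} (hr : r ≠ 0) (s : L) (T : ℕ) :
    (nrPts ξ η r s T).card = T := by
  rw [nrPts, Finset.card_image_of_injective _ (nrPt_injective ξ η hr s), Finset.card_range]

/-- Distinct `γ̲_i` are non-proportional (their first coordinates are both `1`). [folklore] -/
theorem nrPts_general_position [DecidableEq L] (ξ η r s : L) (T : ℕ) :
    ∀ z ∈ nrPts ξ η r s T, ∀ z' ∈ nrPts ξ η r s T, z ≠ z' → ∃ i j, z i * z' j ≠ z j * z' i := by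
  intro z hz z' hz' hne
  rw [nrPts, Finset.mem_image] at hz hz'
  obtain ⟨a, -, rfl⟩ := hz
  obtain ⟨b, -, rfl⟩ := hz'
  by_contra hall
  push Not at hall
  apply hne
  funext k
  have := hall 0 k
  rw [nrPt_zero_apply, nrPt_zero_apply, one_mul, mul_one] at this
  exact this.symm

/-- **`H(I^{(T)}; ν) = T`** for the ideal `I^{(T)}` of the points `γ₀, …, γ_{T−1}` (`r ≠ 0`,
characteristic zero, `ν ≥ T − 1`). [cite: NguyenRoy2016, Definition 9] -/
theorem hilbH_pointIdeal_nrPts [DecidableEq L] [CharZero L] (ξ η : L) {r : L} (hr : r ≠ 0) (s : L) {T ν : ℕ}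
    (hν : T ≤ ν + 1) : hilbH (pointIdeal (nrPts ξ η r s T)) ν = T := by
  rw [hilbH_pointIdeal _ (fun z hz => by
      rw [nrPts, Finset.mem_image] at hz
      obtain ⟨a, -, rfl⟩ := hz
      exact nrPt_ne_zero ξ η r s a)
    (nrPts_general_position ξ η r s T) (by rwa [card_nrPts ξ η hr s T]), card_nrPts ξ η hr s T]

/-- **The determinant `Φ` vanishes to order `T` at each triple of elements of `I_D^{(T)}`**
(Nguyen–Roy, proof of Proposition 15: "the resultant in degree `D` … vanishes up to order `T` at
each triple of elements of `I_D^{(T)}`", here for the determinant `Φ` of [R2012, proof of Thm. 5.2]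
attached to any decomposition data, e.g. the pure powers; `r ≠ 0`, `ν ≥ T − 1`).
[cite: NguyenRoy2016, §5, proof of Proposition 15] -/
theorem X_pow_dvd_aeval_line_detPhi_nrPts [DecidableEq L] [CharZero L] {D ν : ℕ} {P : ℕ → MvPolynomial (Fin 3) L}
    (𝒟 : DecompData L 2 D ν P) (hP : ∀ j, (P j).IsHomogeneous D) (hDν : D ≤ ν)
    (ξ η : L) {r : L} (hr : r ≠ 0) (s : L) {T : ℕ} (hν : T ≤ ν + 1)
    {q : Fin 3 × Fin (veroN 2 D + 1) → L}
    (hq : ∀ i, specForm 2 D q i ∈ pointIdeal (nrPts ξ η r s T))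
    (w : Fin 3 × Fin (veroN 2 D + 1) → L) :
    Polynomial.X ^ T ∣
      aeval (fun v => Polynomial.C (q v) + Polynomial.C (w v) * Polynomial.X)
        (DecompData.detPhi (𝒟 := 𝒟) hP hDν) := by
  rw [← hilbH_pointIdeal_nrPts ξ η hr s (ν := ν) hν]
  exact DecompData.X_pow_hilbH_dvd_aeval_line_detPhi (𝒟 := 𝒟) hP hDν _ hq w

end NRPoints

end PointIdeal

end NguyenRoyK

end Literature.NumberTheory.Transcendental
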